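import Summits.Ventures.MM22.Rank333.GF2ProfileRows
import Summits.MatrixMultiplication.OmegaCensus.SmallFormats.GF2FastSandwich
import HarnessLib

/-!
# ω-census family (a) / cell pub-mm22, v4 (0′)/(0″) glue: validity against ALL certified rows and its SYMMETRY (S-nodes)

Cell `pub-mm22` (MatrixMultiplication venture; HOME `run/shared/lean/pub/pub-mm22/`; seat LIT-2 g9), topic
`Summits/Ventures/MM22`.  HONEST FRAMING: checker PLUMBING, not a result and not a bound.  The whole-root
certificates of the cell (p2 PROFILE-CERT v1, spec `PROFILE-CERT-v1-frozen-20260822T2120Z.md` §1/§3b) state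
«no N-profile is valid against EVERY row `U`» and use, at their S-nodes (symmetry splits), that validity
against all rows is invariant under the symmetries `X ↦ P X Q` and `X ↦ P Xᵀ Q` of the problem ("every row
constraint is G-invariant (lb depends on the G-orbit of U only) … so M is a valid extension iff h(M) is").
This file is that semantic layer, in the kernel's currency `Cert` (certified rows only):

* `ValidAll l m n N prof := ∀ M b, Cert l m n M b → b + #{i : prof i ∈ M} ≤ N` — validity of a profile
  against every CERTIFIED row; `validAll_profileOf` (the profile of every length-`N` computation is valid,
  from `row_le`); `ValidAll.rowsOK` (cited rows are instances); `cert_succ_of_noValidAll`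
  (`Cert [] N` ∧ no valid nonzero `N`-profile ⇒ `Cert [] (N+1)`);
* `preimRow l m σ M` — the patterns `κ < 2^(l m)` with `σ κ ∈ M`; `validAll_comp` — if `σ` transports
  certificates to preimage rows (`Cert M b → Cert (preimRow σ M) b`) then `ValidAll prof → ValidAll (σ ∘ prof)`;
* the two generators of Wang's group `G` in the tree's COMPUTABLE bit conventions:
  `σ = pullB l m P Q` (the pattern of `X ↦ κ(P X Q)`, i.e. `Pᵀ·C_κ·Qᵀ`; `form_sandwich`, GF2FastSandwich.lean)
  transports certificates along `X ↦ P X Q` (`cert_preimRow_pullB`, via `BilinComp.ofSandwichLE` = Wang 2026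
  Lemma 1), and for square first factors `σ = pullTB l P Q` (pattern of `X ↦ κ(P Xᵀ Q)`, `form_sandwichT`)
  transports along `X ↦ P Xᵀ Q` (`cert_preimRow_pullTB`, via `BilinComp.ofTransposeSandwichLE`); hence
  `validAll_comp_pullB`, `validAll_comp_pullTB`.  CONVENTION NOTE for checker authors: the spec's action
  «f ↦ P·f·Q» on coefficient matrices is `pullB l m Pᵀ Qᵀ` here (list the transposed witnesses, or use
  `pullB`/`pullTB` as the executable action); inverse witnesses are bit matrices with `mulBits … Pi P = oneBits`.

So an S-node's WLOG step needs from the tree only: (i) `validAll_comp_pullB` / `validAll_comp_pullTB` for each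
listed generator, (ii) its own finite checks (orbits = closures, IN/OUT/FREE stable).  Row dictionaries stay
`RowsOK`-instances of `ValidAll` (`ValidAll.rowsOK`).
-/

namespace Summit.Ventures.MM22.GF2Cert.Profile

open Summit.MatrixMultiplication.OmegaCensus.GF2RankLB
open Literature.Computability.AlgebraicComplexity
open Module Matrix

variable {l m n N : ℕ}

/-! ## Validity against every certified row -/

/-- **Validity of an `N`-profile against every certified row** (PROFILE-CERT v1 §1 «(ROW_U) for every
subspace U», restricted to the rows the kernel knows: those with a `Cert`). -/
def ValidAll (l m n N : ℕ) (prof : Fin N → ℕ) : Prop :=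
  ∀ (M : List ℕ) (b : ℕ), Cert l m n M b → b + (Finset.univ.filter fun i => prof i ∈ M).card ≤ N

/-- The profile of a length-`N` computation is valid against every certified row (`row_le`). -/
theorem validAll_profileOf (β : BilinComp (mulBilin (ZMod 2) l m n) (Fin N)) :
    ValidAll l m n N (profileOf β) := by
  intro M b h
  have h' := row_le β h
  rwa [Fintype.card_fin] at h'

/-- Cited rows are instances: `ValidAll ⇒ RowsOK rows` for every list of certified rows. -/
theorem ValidAll.rowsOK {prof : Fin N → ℕ} (h : ValidAll l m n N prof) {rows : List (List ℕ × ℕ)}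
    (hrows : ∀ r ∈ rows, Cert l m n r.1 r.2) : RowsOK N rows prof :=
  fun r hr => h r.1 r.2 (hrows r hr)

/-- **«No valid `N`-profile ⇒ `N + 1`»** in the all-rows form: `Cert [] N` and «no profile of `N` nonzero
patterns `< 2^(l m)` is valid against every certified row» give `Cert [] (N + 1)`. -/
theorem cert_succ_of_noValidAll (hN : Cert l m n [] N)
    (hno : ∀ prof : Fin N → ℕ, (∀ i, prof i ≠ 0) → (∀ i, prof i < 2 ^ (l * m)) →
      ValidAll l m n N prof → False) :
    Cert l m n [] (N + 1) := by
  classical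
  intro r β
  have hNr : N ≤ r := hN r β
  by_contra hlt
  have hrN : r = N := by omega
  subst hrN
  have hnz : ∀ i, β.f i ≠ 0 := by
    intro i hi
    have hJ : ∀ j ∈ ({i} : Finset (Fin r)), ∀ u : subOf l m [],
        β.f j (Submodule.inclusion le_rfl u) = 0 := by
      intro j hj u
      rw [Finset.mem_singleton.1 hj, hi]
      rfl
    obtain ⟨γ⟩ := BilinComp.exists_restrictAlong β le_rfl {i} hJ
    have := hN _ γ
    simp only [Fintype.card_fin, Finset.card_singleton] at this
    have hpos : 0 < r := Fin.pos i
    omega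
  refine hno (profileOf (ofNil β)) (fun i => profileOf_ne_zero _ i ?_) (fun i => profileOf_lt _ i)
    (validAll_profileOf (ofNil β))
  rw [Ne, ofNil_f_eq_zero_iff]
  exact hnz i

/-! ## Preimage rows and the abstract invariance -/

/-- The preimage row of `M` under a pattern map `σ`: all patterns `κ < 2^(l m)` with `σ κ ∈ M`. -/
def preimRow (l m : ℕ) (σ : ℕ → ℕ) (M : List ℕ) : List ℕ :=
  (List.range (2 ^ (l * m))).filter fun κ => decide (σ κ ∈ M)

/-- Membership in a preimage row. -/
theorem mem_preimRow {σ : ℕ → ℕ} {M : List ℕ} {κ : ℕ} :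
    κ ∈ preimRow l m σ M ↔ κ < 2 ^ (l * m) ∧ σ κ ∈ M := by
  simp [preimRow, List.mem_filter, List.mem_range]

/-- **Invariance of validity** under a pattern map `σ` that transports certificates to preimage rows:
`ValidAll prof ⇒ ValidAll (σ ∘ prof)` (for profiles of patterns `< 2^(l m)`). -/
theorem validAll_comp {σ : ℕ → ℕ}
    (hσ : ∀ (M : List ℕ) (b : ℕ), Cert l m n M b → Cert l m n (preimRow l m σ M) b)
    {prof : Fin N → ℕ} (hlt : ∀ i, prof i < 2 ^ (l * m)) (h : ValidAll l m n N prof) :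
    ValidAll l m n N (fun i => σ (prof i)) := by
  classical
  intro M b hM
  show b + (Finset.univ.filter fun i => σ (prof i) ∈ M).card ≤ N
  have h1 := h (preimRow l m σ M) b (hσ M b hM)
  have hsub : (Finset.univ.filter fun i => σ (prof i) ∈ M) ⊆
      (Finset.univ.filter fun i => prof i ∈ preimRow l m σ M) := by
    intro i hi
    simp only [Finset.mem_filter, Finset.mem_univ, true_and] at hi ⊢
    exact mem_preimRow.2 ⟨hlt i, hi⟩
  have := Finset.card_le_card hsub
  omega

/-! ## The sandwich `X ↦ P X Q` -/

/-- **Certificate transport to the preimage row of a sandwich** (Wang 2026, Lemma 1): for bit matrices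
`P` (`l × l`) and `Q` (`m × m`) with inverse witnesses `Pi P = 1`, `Q Qi = 1`, a certified row `M`
certifies the row of all `κ` with `pullB l m P Q κ ∈ M` (the forms `X ↦ κ(P X Q)` landing in `M`),
because `X ↦ P X Q` maps `S_M` into that row's subspace. -/
theorem cert_preimRow_pullB {P Pi Q Qi : ℕ} (hP : mulBits l l l Pi P = oneBits l)
    (hQ : mulBits m m m Q Qi = oneBits m) {M : List ℕ} {b : ℕ} (h : Cert l m n M b) :
    Cert l m n (preimRow l m (pullB l m P Q) M) b := by
  intro r γ
  refine h r (γ.ofSandwichLE (ofBits l l P) (ofBits l l Pi) (ofBits m m Q) (ofBits m m Qi)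
    (ofBits_eq_one_of_mulBits_eq hP) (ofBits_eq_one_of_mulBits_eq hQ) ?_)
  intro x hx
  refine mem_constrSub.2 fun κ' hκ' => ?_
  obtain ⟨κ, hκ, rfl⟩ := List.mem_map.1 hκ'
  have hκM : pullB l m P Q κ ∈ M := (mem_preimRow.1 hκ).2
  rw [form_sandwich]
  exact (mem_constrSub.1 hx) _ (List.mem_map.2 ⟨_, hκM, rfl⟩)

/-- **S-node generator, plain sandwich**: validity against all certified rows is preserved by the pattern
action `κ ↦ pullB l m P Q κ` of an invertible sandwich. -/
theorem validAll_comp_pullB {P Pi Q Qi : ℕ} (hP : mulBits l l l Pi P = oneBits l)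
    (hQ : mulBits m m m Q Qi = oneBits m) {prof : Fin N → ℕ} (hlt : ∀ i, prof i < 2 ^ (l * m))
    (h : ValidAll l m n N prof) : ValidAll l m n N (fun i => pullB l m P Q (prof i)) :=
  validAll_comp (fun _ _ hM => cert_preimRow_pullB hP hQ hM) hlt h

/-! ## The transposed sandwich `X ↦ P Xᵀ Q` (square first factor) -/

/-- **Certificate transport to the preimage row of a transposed sandwich** (Wang 2026, Lemma 1 with
the transpose symmetry of §4.1; square first factor `l × l`): with inverse witnesses as above, a
certified row `M` certifies the row of all `κ` with `pullTB l P Q κ ∈ M`. -/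
theorem cert_preimRow_pullTB {P Pi Q Qi : ℕ} (hP : mulBits l l l Pi P = oneBits l)
    (hQ : mulBits l l l Q Qi = oneBits l) {M : List ℕ} {b : ℕ} (h : Cert l l n M b) :
    Cert l l n (preimRow l l (pullTB l P Q) M) b := by
  intro r γ
  refine h r (γ.ofTransposeSandwichLE (ofBits l l P) (ofBits l l Pi) (ofBits l l Q) (ofBits l l Qi)
    (ofBits_eq_one_of_mulBits_eq hP) (ofBits_eq_one_of_mulBits_eq hQ) ?_)
  intro x hx
  refine mem_constrSub.2 fun κ' hκ' => ?_
  obtain ⟨κ, hκ, rfl⟩ := List.mem_map.1 hκ'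
  have hκM : pullTB l P Q κ ∈ M := (mem_preimRow.1 hκ).2
  rw [form_sandwichT]
  exact (mem_constrSub.1 hx) _ (List.mem_map.2 ⟨_, hκM, rfl⟩)

/-- **S-node generator, transposed sandwich**: validity against all certified rows is preserved by
`κ ↦ pullTB l P Q κ`. -/
theorem validAll_comp_pullTB {P Pi Q Qi : ℕ} (hP : mulBits l l l Pi P = oneBits l)
    (hQ : mulBits l l l Q Qi = oneBits l) {prof : Fin N → ℕ} (hlt : ∀ i, prof i < 2 ^ (l * l))
    (h : ValidAll l l n N prof) : ValidAll l l n N (fun i => pullTB l P Q (prof i)) :=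
  validAll_comp (fun _ _ hM => cert_preimRow_pullTB hP hQ hM) hlt h

/-! ## Range of the actions (for chaining generators) -/

/-- `pullB` produces patterns `< 2^(l m)`. -/
theorem pullB_lt (l m P Q κ : ℕ) : pullB l m P Q κ < 2 ^ (l * m) := by
  unfold pullB mulBits
  exact maskOf_lt _ _

/-- `pullTB` produces patterns `< 2^(l l)`. -/
theorem pullTB_lt (l P Q κ : ℕ) : pullTB l P Q κ < 2 ^ (l * l) := by
  unfold pullTB mulBits
  exact maskOf_lt _ _

end Summit.Ventures.MM22.GF2Cert.Profile
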